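import Mathlib
import Literature.Analysis.Convex.CellinaSelectionExplicit
import Literature.Analysis.Convex.SetValuedEquilibria
import HarnessLib

/-!
# Variational inequalities for upper semicontinuous set-valued maps (Aubin, *Optima and Equilibria*, Thm 9.9)

Literature anchor for J.-P. Aubin, *Optima and Equilibria: An Introduction to Nonlinear Analysis*,
GTM 140, Springer 1993 (2nd ed. 1998) [Aubin1993], §9.8 "Variational inequalities".

For a convex compact subset `K` of a Hilbert space `X` and a set-valued map `C : K ⇉ X`, the
**variational inequality** (Def. 9.8, (42)/(43)) asks for
`x̄ ∈ K` and `v̄ ∈ C x̄` with `⟪v̄, x̄ - y⟫ ≥ 0` for all `y ∈ K`,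
i.e. `0 ∈ C x̄ - N_K(x̄)`. We write the conclusion as `⟪v̄, y - x̄⟫ ≤ 0` (the orientation of the
single-valued lemma `SetValuedEquilibria.exists_inner_sub_le_zero`).

* `isCompact_biUnion_of_upperHemicontinuousOn` — an upper hemicontinuous (= upper semicontinuous)
  set-valued map with compact values maps compact sets to compact sets: `⋃ x ∈ K, C x` is compact
  (any topological spaces). [folklore; Aubin–Cellina, *Differential Inclusions*, Prop 1.1.3]
* `exists_mem_inner_sub_le_zero` — **Thm 9.9**: `K` nonempty convex compact in a real inner product
  space, `C` upper hemicontinuous on `K` with nonempty convex compact values `⟹` the variational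
  inequality has a solution. Aubin's proof applies Ky Fan's inequality to `φ(x,y) = -σ(C x, x - y)`;
  the proof here is the equally classical approximation argument: Cellina's approximate selections
  `w_ε` of `C` (`Literature.Analysis.Convex.exists_continuousOn_approxSelection`, Borwein–Lewis
  Thm 8.2.5), the single-valued variational inequality for each `w_ε`
  (`SetValuedEquilibria.exists_inner_sub_le_zero`, from Schauder's fixed point theorem and the metric
  projection), and a limit along a subsequence using the compactness of `K × C(K)` and the closed graph
  of `C` (`Literature.Analysis.Convex.mem_of_upperHemicontinuousWithinAt_of_tendsto`). Completeness of
  the space is not needed.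
* (The single-valued case, Hartman–Stampacchia, is the landed
  `SetValuedEquilibria.exists_inner_sub_le_zero` and is used, not restated.)

Everything is proved; no definitions, no named facts, no `sorry`.
-/

open Set Metric Filter Topology
open scoped RealInnerProductSpace

namespace Literature.Analysis.Convex.SetValuedVariationalInequality

/-! ## Upper hemicontinuous compact-valued maps preserve compactness -/

/-- **USC compact-valued maps send compact sets to compact sets.** If `K` is compact, `C` is upper
hemicontinuous on `K` and every value `C x`, `x ∈ K`, is compact, then `⋃ x ∈ K, C x` is compact.
[folklore] -/
private theorem isCompact_biUnion_of_upperHemicontinuousOn {X Y : Type*} [TopologicalSpace X]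
    [TopologicalSpace Y] {K : Set X} (hK : IsCompact K) {C : X → Set Y}
    (hC : UpperHemicontinuousOn C K) (hc : ∀ x ∈ K, IsCompact (C x)) :
    IsCompact (⋃ x ∈ K, C x) := by
  classical
  refine isCompact_of_finite_subcover fun {ι} U hUo hsub => ?_
  -- finite subcovers of the values
  have hJ : ∀ x, ∃ J : Finset ι, x ∈ K → C x ⊆ ⋃ i ∈ J, U i := by
    intro x
    by_cases hx : x ∈ K
    · obtain ⟨J, hJ⟩ := (hc x hx).elim_finite_subcover U hUo
        ((subset_biUnion_of_mem hx).trans hsub)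
      exact ⟨J, fun _ => hJ⟩
    · exact ⟨∅, fun h => absurd h hx⟩
  choose J hJ using hJ
  -- upper hemicontinuity: `C z ⊆ ⋃ i ∈ J x, U i` for `z ∈ K` in an open neighbourhood `O x` of `x`
  have hO : ∀ x, ∃ O : Set X, IsOpen O ∧ x ∈ O ∧
      (x ∈ K → O ∩ K ⊆ {z | C z ⊆ ⋃ i ∈ J x, U i}) := by
    intro x
    by_cases hx : x ∈ K
    · have hev := (upperHemicontinuousOn_iff_forall_isOpen.1 hC) x hx _
        (isOpen_biUnion fun i _ => hUo i) (hJ x hx)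
      obtain ⟨O, hOo, hxO, hOK⟩ := mem_nhdsWithin.1 hev
      exact ⟨O, hOo, hxO, fun _ => hOK⟩
    · exact ⟨univ, isOpen_univ, mem_univ _, fun h => absurd h hx⟩
  choose O hOo hxO hOK using hO
  obtain ⟨T, hTK, hcover⟩ := hK.elim_nhds_subcover O fun x _ => (hOo x).mem_nhds (hxO x)
  refine ⟨T.biUnion J, fun y hy => ?_⟩
  obtain ⟨z, hzK, hyz⟩ : ∃ z ∈ K, y ∈ C z := by simpa only [mem_iUnion, exists_prop] using hy
  obtain ⟨x, hxT, hzx⟩ : ∃ x ∈ T, z ∈ O x := by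
    simpa only [mem_iUnion, exists_prop] using hcover hzK
  have hCz : C z ⊆ ⋃ i ∈ J x, U i := hOK x (hTK x hxT) ⟨hzx, hzK⟩
  obtain ⟨i, hiJ, hyi⟩ : ∃ i ∈ J x, y ∈ U i := by
    simpa only [mem_iUnion, exists_prop] using hCz hyz
  exact mem_biUnion (Finset.mem_biUnion.2 ⟨x, hxT, hiJ⟩) hyi
#harness_tags isCompact_biUnion_of_upperHemicontinuousOn

/-! ## Theorem 9.9 -/

variable {E : Type*} [NormedAddCommGroup E] [InnerProductSpace ℝ E]

/-- **Aubin Thm 9.9 — variational inequalities for set-valued maps.** Let `K` be a nonempty convex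
compact subset of a real inner product space and `C` a set-valued map, upper hemicontinuous on `K`
with nonempty convex compact values. Then there exist `x̄ ∈ K` and `v̄ ∈ C x̄` with `⟪v̄, y - x̄⟫ ≤ 0`
for every `y ∈ K` (equivalently `⟪v̄, x̄ - y⟫ ≥ 0`, Aubin (43); `0 ∈ C x̄ - N_K(x̄)`, (42)). Proof by
Cellina approximate selections, the single-valued variational inequality and a compactness/closed
graph limit (see the module docstring). [cite: Aubin1993, Thm 9.9] -/
theorem exists_mem_inner_sub_le_zero {K : Set E} (hKc : IsCompact K) (hKconv : Convex ℝ K)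
    (hKne : K.Nonempty) {C : E → Set E} (hC : UpperHemicontinuousOn C K)
    (hne : ∀ x ∈ K, (C x).Nonempty) (hcpt : ∀ x ∈ K, IsCompact (C x))
    (hconv : ∀ x ∈ K, Convex ℝ (C x)) :
    ∃ x ∈ K, ∃ v ∈ C x, ∀ y ∈ K, ⟪v, y - x⟫ ≤ 0 := by
  classical
  -- the image `G = C(K)` is compact
  have hG : IsCompact (⋃ x ∈ K, C x) := isCompact_biUnion_of_upperHemicontinuousOn hKc hC hcpt
  -- approximate selections `w n` at scale `ε n = 1/(n+1)` and solutions `x n` of their VIs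
  set ε : ℕ → ℝ := fun n => 1 / ((n : ℝ) + 1) with hε
  have hεpos : ∀ n, 0 < ε n := fun n => by rw [hε]; positivity
  have hsel : ∀ n : ℕ, ∃ w : E → E, ContinuousOn w K ∧
      ∀ x ∈ K, ∃ x' ∈ K, ∃ y' ∈ C x', ‖x - x'‖ + ‖w x - y'‖ < ε n := fun n => by
    obtain ⟨w, hw, happ, -⟩ := exists_continuousOn_approxSelection hKc hC hne hconv (hεpos n)
    exact ⟨w, hw, happ⟩
  choose w hw happ using hsel
  have hvi : ∀ n, ∃ x ∈ K, ∀ y ∈ K, ⟪w n x, y - x⟫ ≤ 0 := fun n =>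
    SetValuedEquilibria.exists_inner_sub_le_zero hKc hKconv hKne (hw n)
  choose x hxK hxvi using hvi
  have hnear : ∀ n, ∃ x' ∈ K, ∃ y' ∈ C x', ‖x n - x'‖ + ‖w n (x n) - y'‖ < ε n :=
    fun n => happ n (x n) (hxK n)
  choose x' hx'K v' hv'C hdist using hnear
  -- a convergent subsequence of `(x' n, v' n)` in the compact set `K ×ˢ C(K)`
  have hmem : ∀ n, (x' n, v' n) ∈ K ×ˢ ⋃ z ∈ K, C z :=
    fun n => ⟨hx'K n, mem_biUnion (hx'K n) (hv'C n)⟩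
  obtain ⟨⟨xb, vb⟩, ⟨hxbK, -⟩, φ, hφ, hlim⟩ := (hKc.prod hG).tendsto_subseq hmem
  have hlim1 : Tendsto (fun n => x' (φ n)) atTop (𝓝 xb) :=
    (continuous_fst.tendsto _).comp hlim
  have hlim2 : Tendsto (fun n => v' (φ n)) atTop (𝓝 vb) :=
    (continuous_snd.tendsto _).comp hlim
  -- `ε (φ n) → 0`, hence `x (φ n) → xb` and `w (φ n) (x (φ n)) → vb`
  have hεlim : Tendsto (fun n => ε (φ n)) atTop (𝓝 0) := by
    refine squeeze_zero (fun n => (hεpos _).le) (fun n => ?_) tendsto_one_div_add_atTop_nhds_zero_nat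
    show 1 / ((φ n : ℝ) + 1) ≤ 1 / ((n : ℝ) + 1)
    have hle : (n : ℝ) ≤ (φ n : ℝ) := by exact_mod_cast hφ.id_le n
    exact one_div_le_one_div_of_le (by positivity) (by linarith)
  have hlimx : Tendsto (fun n => x (φ n)) atTop (𝓝 xb) := by
    refine hlim1.congr_dist (squeeze_zero (fun n => dist_nonneg) (fun n => ?_) hεlim)
    rw [dist_eq_norm, norm_sub_rev]
    have := hdist (φ n)
    linarith [norm_nonneg (w (φ n) (x (φ n)) - v' (φ n))]
  have hlimw : Tendsto (fun n => w (φ n) (x (φ n))) atTop (𝓝 vb) := by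
    refine hlim2.congr_dist (squeeze_zero (fun n => dist_nonneg) (fun n => ?_) hεlim)
    rw [dist_eq_norm, norm_sub_rev]
    have := hdist (φ n)
    linarith [norm_nonneg (x (φ n) - x' (φ n))]
  -- closed graph: `vb ∈ C xb`
  have hvb : vb ∈ C xb := by
    refine mem_of_upperHemicontinuousWithinAt_of_tendsto (hC xb hxbK) (hcpt xb hxbK).isClosed
      (l := atTop) (u := fun n => x' (φ n)) (v := fun n => v' (φ n))
      (tendsto_nhdsWithin_iff.2 ⟨hlim1, Eventually.of_forall fun n => hx'K _⟩) hlim2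
      (Eventually.of_forall fun n => hv'C _)
  -- pass to the limit in the variational inequalities
  refine ⟨xb, hxbK, vb, hvb, fun y hy => ?_⟩
  have hlimI : Tendsto (fun n => ⟪w (φ n) (x (φ n)), y - x (φ n)⟫) atTop (𝓝 ⟪vb, y - xb⟫) :=
    hlimw.inner (tendsto_const_nhds.sub hlimx)
  exact le_of_tendsto' hlimI fun n => hxvi (φ n) y hy
#harness_tags exists_mem_inner_sub_le_zero

end Literature.Analysis.Convex.SetValuedVariationalInequality
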